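import Mathlib
import HarnessLib
import Summits.Langlands.Statement
import Summits.Langlands.Langlands.Theses.PrimeSwitchSplit
import Literature.NumberTheory.Automorphic.SatakeParameterBoundHolds
import Literature.NumberTheory.Automorphic.AutomorphicRepsGLCleanModel
import Literature.NumberTheory.Automorphic.AutomorphicRepsGLSatakeUnitaryProofs
import Literature.NumberTheory.Automorphic.AutomorphicRepsGLSatakeDictionaryHolds
import Literature.NumberTheory.Automorphic.AutomorphicRepsGLAssociatedL2Holds
import Literature.NumberTheory.Automorphic.AutomorphicRepsGLSatakeFlathProofs
import Literature.NumberTheory.Automorphic.AutomorphicRepsGLCuspidalUnitaryHolds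
import Literature.NumberTheory.Automorphic.AdelicGroupDataAutomorphicMeasureProofs
import Literature.NumberTheory.GaloisRepresentations.IntegralGaloisActionProofs

/-!
# `SatakeWindowCarving` — CENSUS TWIN (pre-birth Theorems file) of the lens-6 g30 NODE (barrier-complement carving), decomp-langlands, RESIDUAL MODE

This file is the node `HOME/nodes/lens-6-g30-SatakeWindowCarving.lean` with its namespace moved from `…Theses.SatakeWindowCarving` to `…Theorems.SatakeWindowCarving` and the `#print axioms` guards removed; NOTHING is asserted beyond kernel-checked theorems (0 sorry): the two pieces and the complement cell are `def … : Prop` COPIES of the route texts (the route decls will be `Iff.rfl`-identical after birth), and every theorem is about the host item `PrimeSwitchSplit.WeakGeometricAutomorphy` (stmt-Langlands-17414) BY NAME. Supports stmt-Langlands-17414.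

TARGET (used BY NAME, never restated): the rank-2 crux `Summit.Langlands.Langlands.Theses.PrimeSwitchSplit.WeakGeometricAutomorphy`
(stmt-Langlands-17414, the (B)-core `B_w` of N0′ = route `PrimeSwitchSplit`; tree text 868 ch, sha12 7d281a15be13): every IRREDUCIBLE
GEOMETRIC (a.e. unramified, de Rham above `ℓ`) `ρ : Γ_K → GL_n(ℚ̄_ℓ)` is WEAKLY AUTOMORPHIC — some L-algebraic cuspidal `π` of `GL_n(𝔸_K)`
is Satake–Frobenius compatible with `ρ` at almost all places (through `ι : ℚ̄_ℓ ≃ ℂ`).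

THE DIAL `D(K,ℓ,ι,ρ)` = **a UNIFORM WEIGHT WINDOW** (`HasWeightWindow`, the text inserted verbatim after the irreducibility binder of
`B_w`): ONE real number `w` such that at almost every finite place `v`, every root `β` of every Frobenius characteristic polynomial of
`ρ` at `v` has `q_v^{(w-1)/2} ≤ |ι β| ≤ q_v^{(w+1)/2}` — the Galois-side shadow of the JACQUET–SHALIKA window
`q_v^{-1/2} ≤ |α| ≤ q_v^{1/2}` of a unitary cuspidal Satake parameter [JacquetShalikaAJM1981, (5.1.3) p. 554, Cor. (2.5)] transported
through the L-normalised dictionary `β = ι⁻¹(α⁻¹)` (`arithFrobPolyOfSatake ι q_v 1 α`, [BuzzardGeeLMS2014, §2.1, Conj. 3.2.1]) and the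
unitary normalisation `π ⊗ |det|^{s₀}` of a Borel–Jacquet datum [BorelJacquetCorvallis1979, §4.6 and 5.7].

CELLS.  `B_w ⟺ WWA ∧ OFFW` (pointwise excluded middle on the dial, `weakAut_iff_cells`):
* WWA `WindowedWeakAutomorphy` = `B_w` on the ρ INSIDE some uniform window — tag WEAKER · S-implied · DECLARED RESIDUAL (rank 3): every
  engine that has ever produced a `π` from a `ρ` lands here, because its OUTPUT is windowed (certificate `gww_of_weakAut`).
* OFFW `OffWindowWeakAutomorphy` = `B_w` on the ρ with NO uniform window — node-only; CERTIFIED S-VOID IN KERNEL: `offw_of_gww` closes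
  it VACUOUSLY from the Galois-side crux, and `gww_of_weakAut : B_w → GaloisWeightWindow` shows the carved class is EMPTY under the
  target itself (so, unlike an EXCESS test, the carving loses nothing: `pieces_iff_target : (GWW ∧ WWA) ↔ B_w`).
* GWW `GaloisWeightWindow` (crux, rank 2, NEW, purely GALOIS-THEORETIC — no automorphic object in its text): every irreducible geometric
  `ρ` has a uniform weight window.  PRINT places it strictly between nothing-known and Fontaine–Mazur–Langlands: it follows from weak
  automorphy (this file, kernel) and is known exactly where automorphy or motivic purity is known (n = 1: Weil / Serre, locally
  algebraic characters; regular totally odd essentially (conjugate-)self-dual compatible systems: Patrikis–Taylor, arXiv:1307.1640,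
  Thm. A «irreducible ⇒ pure»; BLGGT arXiv:1010.2561); for a general irreducible de Rham `ρ` not even the algebraicity of the Frobenius
  eigenvalues is known (Fontaine–Mazur 1995, Conj. 1).  WHY EASIER than `B_w`: it asks for ONE real inequality per place, not for a `π`;
  it is stable under twists by geometric characters (`w ↦ w + 2k`), duals (`w ↦ -w`) and restriction to `K'/K` (same `w`, `q ↦ q^f`),
  so orbit-closed for the cell's frame moves; and its first rungs are decidable matrix algebra (`finiteOrderWindowRung`).

EXACTNESS mod NOTHING: `weakAut_iff_cells`, `closes_child : GWW → WWA → B_w`, `gww_of_weakAut`, `wwa_of_target`, `pieces_iff_target`.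
`closes : GWW → WWA → (W⁺, P, A, R of the host route) → Langlands` through `PrimeSwitchSplit.closes` (BY NAME).
LEAVES: rung `FiniteOrderWindowRung` (GWW on finite-order ρ: PROVED, `finiteOrderWindowRung`; S there = strong Artin, OPEN for n ≥ 2);
plan-only rung `RankOneWindowRung` (n = 1; PRINT Weil 1956 / Serre 1968 Ch. III: geometric ⇒ locally algebraic ⇒ type A₀ ⇒ weight).

Kernel: Lean 4 + Mathlib, imports = accepted tree modules only; axioms ⊆ {propext, Classical.choice, Quot.sound} (`#print axioms` guards at
the end).  No `sorry`.
-/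

set_option linter.dupNamespace false -- project-wide option (lakefile weak.linter.dupNamespace); `Summit.Langlands.Langlands` is the mandated namespace

namespace Summit.Langlands.Langlands.Theorems.SatakeWindowCarving

open scoped BigOperators Topology Manifold Classical MeasureTheory ProbabilityTheory Matrix InnerProductSpace ComplexConjugate ContinuousMap
open Filter Set Function TopologicalSpace MeasureTheory

/-! ## The route items (texts = `B_w` verbatim + ONE insertion after the anchor `ρ.toGaloisRep.IsIrreducible → `; GWW = Galois prefix + conclusion) -/

/-- crux (rank 2) · GWW · every irreducible geometric `ρ : Γ_K → GL_n(ℚ̄_ℓ)` has a UNIFORM WEIGHT WINDOW: one real `w` with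
`q_v^{(w-1)/2} ≤ |ι β| ≤ q_v^{(w+1)/2}` for every Frobenius root `β` at almost every `v` — tag WEAKER · S-implied (`gww_of_weakAut`) · NEW ·
purely Galois-theoretic. [conjecture] -/
def GaloisWeightWindow : Prop :=
  ∀ (K : Type) [Field K] [NumberField K] (n : ℕ), 0 < n → ∀ (ℓ : ℕ) [Fact ℓ.Prime] (ι : PadicAlgCl ℓ ≃+* ℂ) (ρ : Literature.NumberTheory.GaloisRepresentations.FramedGaloisRep K (PadicAlgCl ℓ) n), ρ.toGaloisRep.IsIrreducible → ((∀ᶠ v : IsDedekindDomain.HeightOneSpectrum (NumberField.RingOfIntegers K) in cofinite, ρ.IsUnramifiedAt v) ∧ ∀ (v : IsDedekindDomain.HeightOneSpectrum (NumberField.RingOfIntegers K)) (hv : ((ℓ : ℕ) : NumberField.RingOfIntegers K) ∈ v.asIdeal), (Literature.NumberTheory.PAdicHodge.fontainePstAdicCompletion v ℓ hv).IsDeRhamFramed (ρ.toLocal v)) → (∃ w : ℝ, ∀ᶠ v : IsDedekindDomain.HeightOneSpectrum (NumberField.RingOfIntegers K) in Filter.cofinite, ∀ P : Polynomial (PadicAlgCl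 ℓ), ρ.HasFrobCharpolyAt v P → ∀ β ∈ P.roots, (v.residueCard : ℝ) ^ ((w - 1) / 2) ≤ ‖ι β‖ ∧ ‖ι β‖ ≤ (v.residueCard : ℝ) ^ ((w + 1) / 2))

/-- residual (rank 3) · WWA · `B_w` on the ρ INSIDE a uniform weight window — tag WEAKER · S-implied · DECLARED RESIDUAL (every engine
lives here). [conjecture] -/
def WindowedWeakAutomorphy : Prop :=
  ∀ (K : Type) [Field K] [NumberField K] (n : ℕ) (hcpt : Literature.NumberTheory.Automorphic.isCompact_glFiniteIntegralLevel n K), 0 < n → ∀ (ℓ : ℕ) [Fact ℓ.Prime] (ι : PadicAlgCl ℓ ≃+* ℂ) (ρ : Literature.NumberTheory.GaloisRepresentations.FramedGaloisRep K (PadicAlgCl ℓ) n), ρ.toGaloisRep.IsIrreducible → (∃ w : ℝ, ∀ᶠ v : IsDedekindDomain.HeightOneSpectrum (NumberField.RingOfIntegers K) in Filter.cofinite, ∀ P : Polynomial (PadicAlgCl ℓ), ρ.HasFrobCharpolyAt v P → ∀ β ∈ P.roots, (v.residueCard : ℝ) ^ ((w - 1) / 2) ≤ ‖ι β‖ ∧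 ‖ι β‖ ≤ (v.residueCard : ℝ) ^ ((w + 1) / 2)) → ((∀ᶠ v : IsDedekindDomain.HeightOneSpectrum (NumberField.RingOfIntegers K) in cofinite, ρ.IsUnramifiedAt v) ∧ ∀ (v : IsDedekindDomain.HeightOneSpectrum (NumberField.RingOfIntegers K)) (hv : ((ℓ : ℕ) : NumberField.RingOfIntegers K) ∈ v.asIdeal), (Literature.NumberTheory.PAdicHodge.fontainePstAdicCompletion v ℓ hv).IsDeRhamFramed (ρ.toLocal v)) → ∃ π : Literature.NumberTheory.Automorphic.CuspidalAutomorphicRepData n K hcpt, π.1.IsLAlgebraic ∧ ∀ᶠ v : IsDedekindDomain.HeightOneSpectrum (NumberField.RingOfIntegers K) in cofinite, SatakeFrobCompatibleAt ι π.1 ρ v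

/-- complement cell (node-only, NOT a route item) · OFFW · `B_w` on the ρ with NO uniform weight window — CERTIFIED S-VOID
(`offw_of_gww`, `gww_of_weakAut`). [conjecture] -/
def OffWindowWeakAutomorphy : Prop :=
  ∀ (K : Type) [Field K] [NumberField K] (n : ℕ) (hcpt : Literature.NumberTheory.Automorphic.isCompact_glFiniteIntegralLevel n K), 0 < n → ∀ (ℓ : ℕ) [Fact ℓ.Prime] (ι : PadicAlgCl ℓ ≃+* ℂ) (ρ : Literature.NumberTheory.GaloisRepresentations.FramedGaloisRep K (PadicAlgCl ℓ) n), ρ.toGaloisRep.IsIrreducible → ¬ (∃ w : ℝ, ∀ᶠ v : IsDedekindDomain.HeightOneSpectrum (NumberField.RingOfIntegers K) in Filter.cofinite, ∀ P : Polynomial (PadicAlgCl ℓ), ρ.HasFrobCharpolyAt v P → ∀ β ∈ P.roots, (v.residueCard : ℝ) ^ ((w - 1) / 2) ≤ ‖ι β‖ ∧ ‖ι β‖ ≤ (v.residueCard : ℝ) ^ ((w + 1) / 2)) → ((∀ᶠ v : IsDedekindDomain.HeightOneSpectrum (NumberField.RingOfIntegers K) in cofinite, ρ.IsUnramifiedAt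 v) ∧ ∀ (v : IsDedekindDomain.HeightOneSpectrum (NumberField.RingOfIntegers K)) (hv : ((ℓ : ℕ) : NumberField.RingOfIntegers K) ∈ v.asIdeal), (Literature.NumberTheory.PAdicHodge.fontainePstAdicCompletion v ℓ hv).IsDeRhamFramed (ρ.toLocal v)) → ∃ π : Literature.NumberTheory.Automorphic.CuspidalAutomorphicRepData n K hcpt, π.1.IsLAlgebraic ∧ ∀ᶠ v : IsDedekindDomain.HeightOneSpectrum (NumberField.RingOfIntegers K) in cofinite, SatakeFrobCompatibleAt ι π.1 ρ v

/-- the route-level assembly = the host crux recovered from the crux and the residual (node-local statement; no fact tag —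
proved below as `assembly_holds`). -/
def ChildAssembly : Prop :=
  GaloisWeightWindow → WindowedWeakAutomorphy → Summit.Langlands.Langlands.Theses.PrimeSwitchSplit.WeakGeometricAutomorphy

/-! ## The dial (named) and its first rungs -/

section Dial

open IsDedekindDomain NumberField Literature.NumberTheory.GaloisRepresentations

variable (K : Type) [Field K] [NumberField K] (ℓ : ℕ) [Fact ℓ.Prime]

/-- THE DIAL `D(K,ℓ,ι,ρ)`: `ρ` HAS A UNIFORM WEIGHT WINDOW — one real `w` such that at almost every finite place every root `β` of a
Frobenius characteristic polynomial of `ρ` satisfies `q_v^{(w-1)/2} ≤ |ι β| ≤ q_v^{(w+1)/2}` (the Jacquet–Shalika window read on the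
Galois side through `β = ι⁻¹(α⁻¹)`).  The body is LITERALLY the text inserted into `B_w` (`wwa_iff_named`). [folklore] -/
def HasWeightWindow (ι : PadicAlgCl ℓ ≃+* ℂ) {n : ℕ} (ρ : FramedGaloisRep K (PadicAlgCl ℓ) n) : Prop :=
  ∃ w : ℝ, ∀ᶠ v : IsDedekindDomain.HeightOneSpectrum (NumberField.RingOfIntegers K) in Filter.cofinite, ∀ P : Polynomial (PadicAlgCl ℓ), ρ.HasFrobCharpolyAt v P → ∀ β ∈ P.roots, (v.residueCard : ℝ) ^ ((w - 1) / 2) ≤ ‖ι β‖ ∧ ‖ι β‖ ≤ (v.residueCard : ℝ) ^ ((w + 1) / 2)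

variable {K ℓ}

/-- a window is insensitive to WHICH Frobenius polynomial is windowed: it suffices to window, at almost every place, the roots of SOME
Frobenius polynomial (uniqueness of Frobenius polynomials over a number field: a prime above `v` and a Frobenius at it exist). [folklore] -/
theorem hasWeightWindow_of_eventually (ι : PadicAlgCl ℓ ≃+* ℂ) {n : ℕ} (ρ : FramedGaloisRep K (PadicAlgCl ℓ) n) (w : ℝ)
    (h : ∀ᶠ v : HeightOneSpectrum (𝓞 K) in Filter.cofinite, ∃ P : Polynomial (PadicAlgCl ℓ), ρ.HasFrobCharpolyAt v P ∧
      ∀ β ∈ P.roots, (v.residueCard : ℝ) ^ ((w - 1) / 2) ≤ ‖ι β‖ ∧ ‖ι β‖ ≤ (v.residueCard : ℝ) ^ ((w + 1) / 2)) :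
    HasWeightWindow K ℓ ι ρ := by
  refine ⟨w, ?_⟩
  filter_upwards [h] with v hv
  obtain ⟨P, hP, hwin⟩ := hv
  intro Q hQ β hβ
  obtain ⟨𝔓, h𝔓⟩ := v.primesAbove_nonempty
  obtain ⟨σ, hσ⟩ := HeightOneSpectrum.exists_isArithFrobAt_of_mem_primesAbove_holds h𝔓
  have hPQ : Q = P := by rw [← hQ 𝔓 h𝔓 σ hσ, ← hP 𝔓 h𝔓 σ hσ]
  exact hwin β (hPQ ▸ hβ)

/-- FIRST RUNG, kernel: a FINITE-ORDER `ρ` (`ρ(σ)^k = 1` for all `σ`, e.g. an Artin representation) has the window `w = 0`: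
every Frobenius root is a `k`-th root of unity, so `|ι β| = 1 ∈ [q_v^{-1/2}, q_v^{1/2}]`. [folklore] -/
theorem hasWeightWindow_of_finiteOrder (ι : PadicAlgCl ℓ ≃+* ℂ) {n : ℕ} (ρ : FramedGaloisRep K (PadicAlgCl ℓ) n)
    {k : ℕ} (hk : 0 < k) (hρ : ∀ σ : Field.absoluteGaloisGroup K, ρ σ ^ k = 1) : HasWeightWindow K ℓ ι ρ := by
  classical
  refine ⟨0, Filter.Eventually.of_forall fun v P hP β hβ => ?_⟩
  obtain ⟨𝔓, h𝔓⟩ := v.primesAbove_nonempty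
  obtain ⟨σ, hσ⟩ := HeightOneSpectrum.exists_isArithFrobAt_of_mem_primesAbove_holds h𝔓
  have hPσ : P = ((ρ σ : GL (Fin n) (PadicAlgCl ℓ)) : Matrix (Fin n) (Fin n) (PadicAlgCl ℓ)).charpoly := (hP 𝔓 h𝔓 σ hσ).symm
  set M : Matrix (Fin n) (Fin n) (PadicAlgCl ℓ) := ((ρ σ : GL (Fin n) (PadicAlgCl ℓ)) : Matrix (Fin n) (Fin n) (PadicAlgCl ℓ)) with hM
  have hMk : M ^ k = 1 := by
    rw [hM, ← Units.val_pow_eq_pow_val, hρ σ, Units.val_one]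
  have hroot : Polynomial.IsRoot M.charpoly β := by
    rw [← hPσ]; exact Polynomial.isRoot_of_mem_roots hβ
  -- `n = 0`: the characteristic polynomial is `1` and has no roots
  rcases Nat.eq_zero_or_pos n with hn0 | hnpos
  · exfalso
    subst hn0
    have h1 : M.charpoly = 1 := by unfold Matrix.charpoly; exact Matrix.det_isEmpty
    rw [hPσ, h1, Polynomial.roots_one] at hβ
    exact Multiset.notMem_zero _ hβ
  haveI : Nonempty (Fin n) := ⟨⟨0, hnpos⟩⟩
  have hspec : β ∈ spectrum (PadicAlgCl ℓ) M := Matrix.mem_spectrum_of_isRoot_charpoly hroot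
  have hspeck : β ^ k ∈ spectrum (PadicAlgCl ℓ) (M ^ k) := spectrum.pow_mem_pow M k hspec
  rw [hMk, spectrum.one_eq, Set.mem_singleton_iff] at hspeck
  have hn1 : ‖ι β‖ = 1 := by
    have h1 : ‖ι β‖ ^ k = 1 := by rw [← norm_pow, ← map_pow, hspeck, map_one, norm_one]
    exact (pow_eq_one_iff_of_nonneg (norm_nonneg _) hk.ne').1 h1
  have hq1 : (1 : ℝ) ≤ (v.residueCard : ℝ) := by exact_mod_cast v.one_lt_residueCard.le
  rw [hn1]
  constructor
  · exact Real.rpow_le_one_of_one_le_of_nonpos hq1 (by norm_num)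
  · exact Real.one_le_rpow hq1 (by norm_num)

end Dial

/-! ## Kernel: EXACT mod NOTHING; closes; the carved class is S-VOID -/

section Kernel

open IsDedekindDomain NumberField Literature.NumberTheory.Automorphic Literature.NumberTheory.GaloisRepresentations

/-- the windowed cell IS `B_w` guarded by the named dial (definitional identity, binder-for-binder). [folklore] -/
theorem wwa_iff_named : WindowedWeakAutomorphy ↔
    (∀ (K : Type) [Field K] [NumberField K] (n : ℕ) (hcpt : Literature.NumberTheory.Automorphic.isCompact_glFiniteIntegralLevel n K),
      0 < n → ∀ (ℓ : ℕ) [Fact ℓ.Prime] (ι : PadicAlgCl ℓ ≃+* ℂ)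
      (ρ : Literature.NumberTheory.GaloisRepresentations.FramedGaloisRep K (PadicAlgCl ℓ) n), ρ.toGaloisRep.IsIrreducible →
      HasWeightWindow K ℓ ι ρ → ((∀ᶠ v : IsDedekindDomain.HeightOneSpectrum (NumberField.RingOfIntegers K) in cofinite, ρ.IsUnramifiedAt v) ∧ ∀ (v : IsDedekindDomain.HeightOneSpectrum (NumberField.RingOfIntegers K)) (hv : ((ℓ : ℕ) : NumberField.RingOfIntegers K) ∈ v.asIdeal), (Literature.NumberTheory.PAdicHodge.fontainePstAdicCompletion v ℓ hv).IsDeRhamFramed (ρ.toLocal v)) → ∃ π : Literature.NumberTheory.Automorphic.CuspidalAutomorphicRepData n K hcpt, π.1.IsLAlgebraic ∧ ∀ᶠ v : IsDedekindDomain.HeightOneSpectrum (NumberField.RingOfIntegers K) in cofinite, SatakeFrobCompatibleAt ι π.1 ρ v) :=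
  ⟨fun h K _ _ n hcpt hn ℓ _ ι ρ hirr hD hgeo => h K n hcpt hn ℓ ι ρ hirr hD hgeo,
    fun h K _ _ n hcpt hn ℓ _ ι ρ hirr hD hgeo => h K n hcpt hn ℓ ι ρ hirr hD hgeo⟩

/-- idem for the complement cell. [folklore] -/
theorem offw_iff_named : OffWindowWeakAutomorphy ↔
    (∀ (K : Type) [Field K] [NumberField K] (n : ℕ) (hcpt : Literature.NumberTheory.Automorphic.isCompact_glFiniteIntegralLevel n K),
      0 < n → ∀ (ℓ : ℕ) [Fact ℓ.Prime] (ι : PadicAlgCl ℓ ≃+* ℂ)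
      (ρ : Literature.NumberTheory.GaloisRepresentations.FramedGaloisRep K (PadicAlgCl ℓ) n), ρ.toGaloisRep.IsIrreducible →
      ¬ HasWeightWindow K ℓ ι ρ → ((∀ᶠ v : IsDedekindDomain.HeightOneSpectrum (NumberField.RingOfIntegers K) in cofinite, ρ.IsUnramifiedAt v) ∧ ∀ (v : IsDedekindDomain.HeightOneSpectrum (NumberField.RingOfIntegers K)) (hv : ((ℓ : ℕ) : NumberField.RingOfIntegers K) ∈ v.asIdeal), (Literature.NumberTheory.PAdicHodge.fontainePstAdicCompletion v ℓ hv).IsDeRhamFramed (ρ.toLocal v)) → ∃ π : Literature.NumberTheory.Automorphic.CuspidalAutomorphicRepData n K hcpt, π.1.IsLAlgebraic ∧ ∀ᶠ v : IsDedekindDomain.HeightOneSpectrum (NumberField.RingOfIntegers K) in cofinite, SatakeFrobCompatibleAt ι π.1 ρ v) :=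
  ⟨fun h K _ _ n hcpt hn ℓ _ ι ρ hirr hD hgeo => h K n hcpt hn ℓ ι ρ hirr hD hgeo,
    fun h K _ _ n hcpt hn ℓ _ ι ρ hirr hD hgeo => h K n hcpt hn ℓ ι ρ hirr hD hgeo⟩

/-- idem for the Galois-side crux: its conclusion IS the named dial. [folklore] -/
theorem gww_iff_named : GaloisWeightWindow ↔
    (∀ (K : Type) [Field K] [NumberField K] (n : ℕ), 0 < n → ∀ (ℓ : ℕ) [Fact ℓ.Prime] (ι : PadicAlgCl ℓ ≃+* ℂ)
      (ρ : Literature.NumberTheory.GaloisRepresentations.FramedGaloisRep K (PadicAlgCl ℓ) n), ρ.toGaloisRep.IsIrreducible →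
      ((∀ᶠ v : IsDedekindDomain.HeightOneSpectrum (NumberField.RingOfIntegers K) in cofinite, ρ.IsUnramifiedAt v) ∧ ∀ (v : IsDedekindDomain.HeightOneSpectrum (NumberField.RingOfIntegers K)) (hv : ((ℓ : ℕ) : NumberField.RingOfIntegers K) ∈ v.asIdeal), (Literature.NumberTheory.PAdicHodge.fontainePstAdicCompletion v ℓ hv).IsDeRhamFramed (ρ.toLocal v)) → HasWeightWindow K ℓ ι ρ) :=
  ⟨fun h K _ _ n hn ℓ _ ι ρ hirr hgeo => h K n hn ℓ ι ρ hirr hgeo,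
    fun h K _ _ n hn ℓ _ ι ρ hirr hgeo => h K n hn ℓ ι ρ hirr hgeo⟩

/-- **EXACTNESS**: `B_w ↔ (WWA ∧ OFFW)` — pointwise excluded middle on the dial. [folklore] -/
theorem weakAut_iff_cells : Summit.Langlands.Langlands.Theses.PrimeSwitchSplit.WeakGeometricAutomorphy ↔ (WindowedWeakAutomorphy ∧ OffWindowWeakAutomorphy) := by
  constructor
  · intro h
    exact ⟨fun K _ _ n hcpt hn ℓ _ ι ρ hirr _ hgeo => h K n hcpt hn ℓ ι ρ hirr hgeo,
      fun K _ _ n hcpt hn ℓ _ ι ρ hirr _ hgeo => h K n hcpt hn ℓ ι ρ hirr hgeo⟩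
  · rintro ⟨hW, hO⟩ K _ _ n hcpt hn ℓ _ ι ρ hirr hgeo
    exact Classical.byCases (fun hD => hW K n hcpt hn ℓ ι ρ hirr hD hgeo) (fun hD => hO K n hcpt hn ℓ ι ρ hirr hD hgeo)

/-- WWA is WEAKER than the target (restriction). [folklore] -/
theorem wwa_of_target (h : Summit.Langlands.Langlands.Theses.PrimeSwitchSplit.WeakGeometricAutomorphy) : WindowedWeakAutomorphy := (weakAut_iff_cells.1 h).1

/-- OFFW is WEAKER than the target (restriction). [folklore] -/
theorem offw_of_target (h : Summit.Langlands.Langlands.Theses.PrimeSwitchSplit.WeakGeometricAutomorphy) : OffWindowWeakAutomorphy := (weakAut_iff_cells.1 h).2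

/-- the Galois-side crux closes the complement cell VACUOUSLY: under GWW no irreducible geometric ρ is off-window. [folklore] -/
theorem offw_of_gww (h : GaloisWeightWindow) : OffWindowWeakAutomorphy :=
  fun K _ _ n _hcpt hn ℓ _ ι ρ hirr hD hgeo => absurd (h K n hn ℓ ι ρ hirr hgeo) hD

/-- the child route's deciding seam: crux + residual give the host crux BY NAME. [folklore] -/
theorem closes_child (hG : GaloisWeightWindow) (hW : WindowedWeakAutomorphy) : Summit.Langlands.Langlands.Theses.PrimeSwitchSplit.WeakGeometricAutomorphy :=
  weakAut_iff_cells.2 ⟨hW, offw_of_gww hG⟩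

/-- `ChildAssembly` holds (it is `closes_child`; named `Assembly` in the node — renamed here because a helper may not declare a registry-owned name). [folklore] -/
theorem childAssembly_holds : ChildAssembly := closes_child

/-- **closes_root** (census twin: a helper may not declare `closes`, rule G35 (b)): the crux, the residual and the host route's other cruxes (W⁺ = `SatakeAvatarExistence`, P = `PadicMemberCompatibility`,
A = `CompatibilityAwayFromLR`, R = `CanonicalReciprocityData`; `AvatarConjugacy` is PROVED in the host file) give `Langlands`. [folklore] -/
theorem closes_root (hG : GaloisWeightWindow) (hW : WindowedWeakAutomorphy) (hWp : Summit.Langlands.Langlands.Theses.PrimeSwitchSplit.SatakeAvatarExistence)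
    (hPm : Summit.Langlands.Langlands.Theses.PrimeSwitchSplit.PadicMemberCompatibility) (hA : Summit.Langlands.Langlands.Theses.PrimeSwitchSplit.CompatibilityAwayFromLR) (hR : Summit.Langlands.Langlands.Theses.PrimeSwitchSplit.CanonicalReciprocityData) :
    _root_.Langlands :=
  Summit.Langlands.Langlands.Theses.PrimeSwitchSplit.closes (closes_child hG hW) hWp hPm hA hR Summit.Langlands.Langlands.Theses.PrimeSwitchSplit.AvatarConjugacy_holds

/-- the host crux is implied by the summit (re-proved inline; = `weak_of_langlands` of Theorems/DepthPrimeSplitClassicalityWeight — kept `private` here (dedup.landed; importing that module would pull two further Theses files into this helper's cone). [folklore] -/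
private theorem target_of_langlands (hL : _root_.Langlands) : Summit.Langlands.Langlands.Theses.PrimeSwitchSplit.WeakGeometricAutomorphy := by
  intro K _ _ n hcpt hn ℓ _ ι ρ hirr hgeo
  obtain ⟨⟨Rec⟩, h⟩ := hL K
  obtain ⟨π, hπ, hcorr⟩ := (h Rec n hn hcpt).2 ℓ ι ρ hirr ⟨hgeo.1, fun v hv => hgeo.2 v hv⟩
  exact ⟨π, hπ, hcorr.1⟩

/-- WWA is S-implied. [folklore] -/
theorem wwa_of_langlands (hL : _root_.Langlands) : WindowedWeakAutomorphy := wwa_of_target (target_of_langlands hL)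

/-- **THE CARVED CLASS IS S-VOID (kernel certificate)**: the TARGET itself implies the Galois-side crux — a weakly automorphic
irreducible `ρ` has the uniform window `w = 2 re μ / (n[K:ℚ])` read off the `A_G`-exponent `μ` of a CLEAN MODEL `π₀` of its `π`
(`exists_clean_hasSatakeParamAt_of_sSup_irreducible`): the unitary normalisation `π₀ ⊗ |det|^{s₀}`, `s₀ = -μ/(n[K:ℚ])`, is sent to
`L²_cusp` (`exists_isAssociatedL2_holds`, `hasSatakeParamAt_iff_L2_holds`) where JACQUET–SHALIKA (5.1.3) bounds its Satake parameters by
`q_v^{1/2}` (`norm_satakeParameter_le_sqrt_holds`); the conjugation shadow `{ā} = {q_v^{r} a⁻¹}`, `r = 2 re s₀`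
(`conj_shadow_of_apply_posRealScalar_mul_eq_cpow`) turns the upper bound into the lower one; Satake parameters are unique
(`hasSatakeParamAt_unique_holds`, Flath) so the ρ-matching parameter of `B_w` is windowed; and `β = ι⁻¹(a⁻¹)`
(`roots_arithFrobPolyOfSatake`) with uniqueness of Frobenius polynomials transports the window to EVERY Frobenius polynomial of `ρ`. [folklore] -/
theorem gww_of_weakAut (h : Summit.Langlands.Langlands.Theses.PrimeSwitchSplit.WeakGeometricAutomorphy) : GaloisWeightWindow := by
  intro K _ _ n hn ℓ _ ι ρ hirr hgeo
  classical
  haveI : NeZero n := ⟨hn.ne'⟩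
  have hcpt : isCompact_glFiniteIntegralLevel n K := isCompact_glFiniteIntegralLevel_holds n K
  obtain ⟨π, -, hcomp⟩ := h K n hcpt hn ℓ ι ρ hirr hgeo
  -- a clean model `π₀` of `π` (every Satake parameter of `π₀` is one of `π`)
  obtain ⟨π₀, h0W', h0π⟩ := CuspidalAutomorphicRepData.exists_clean_hasSatakeParamAt_of_sSup_irreducible
    AutomorphicRepsGL.stable_cuspidal_eq_sSup_irreducible_holds π
  -- the `A_G`-exponent `μ` of `π₀`, the normalising exponent `s₀ = -μ / (n [K:ℚ])` and the character `|·|^{s₀}`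
  obtain ⟨μ, hμ⟩ := π₀.1.exists_apply_posRealScalar_mul_eq_cpow h0W'
  have hnd : ((n * Module.finrank ℚ K : ℕ) : ℂ) ≠ 0 := by
    exact_mod_cast (Nat.mul_ne_zero (NeZero.ne n) Module.finrank_pos.ne')
  set s₀ : ℂ := -μ / (n * Module.finrank ℚ K : ℕ) with hs₀
  have hs : s₀ * (n * Module.finrank ℚ K : ℕ) = -μ := by rw [hs₀, div_mul_cancel₀ _ hnd]
  set r : ℝ := -(2 * μ.re) / (n * Module.finrank ℚ K : ℕ) with hr
  have hre : 2 * s₀.re = r := by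
    rw [hr, hs₀, ← Complex.ofReal_natCast, Complex.div_ofReal_re, Complex.neg_re]
    ring
  obtain ⟨χ, hχ⟩ := exists_heckeCharacter_ideleNorm_cpow K s₀
  -- the unitary normalisation `π₁ = π₀ ⊗ |det|^{s₀}`: clean, with `A_G`-invariant forms, hence realised in `L²_cusp`
  obtain ⟨π₁, h1W, h1W'⟩ := exists_cuspidalAutomorphicRepData_map_mulChar_detTwist hχ π₀
  have hAG : ∀ φ ∈ π₁.1.W, ∀ z ∈ (AdelicGroupData.gl n K).center', ∀ g, φ (z * g) = φ g := by
    intro φ hφ z hz g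
    rw [h1W] at hφ
    obtain ⟨φ₀, hφ₀, rfl⟩ := hφ
    obtain ⟨t, rfl⟩ := hz
    exact mulChar_detTwist_apply_posRealScalar_mul_of_cpow hχ hs (hμ φ₀ hφ₀) t g
  obtain ⟨μm, hμm⟩ := AdelicGroupData.exists_isAutomorphicMeasure_gl_holds n K
  haveI := hμm
  obtain ⟨P, hP⟩ := AutomorphicRepsGL.exists_isAssociatedL2_holds hcpt μm π₁ hAG
  -- KEY: every Satake parameter of the clean model lies in the window `[q^{(r-1)/2}, q^{(r+1)/2}]` and is non-zero
  have key : ∀ (v : HeightOneSpectrum (𝓞 K)) (α : Multiset ℂ), π₀.1.HasSatakeParamAt v α →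
      ∀ a ∈ α, a ≠ 0 ∧ (v.residueCard : ℝ) ^ ((r - 1) / 2) ≤ ‖a‖ ∧ ‖a‖ ≤ (v.residueCard : ℝ) ^ ((r + 1) / 2) := by
    intro v α hα
    have hq : (0 : ℝ) < (v.residueCard : ℝ) := by exact_mod_cast Nat.zero_lt_of_lt v.one_lt_residueCard
    -- conjugation shadow of the clean model: `0 ∉ α`, `{ā} = {q^r a⁻¹}`
    obtain ⟨hne, hconj⟩ := π₀.conj_shadow_of_apply_posRealScalar_mul_eq_cpow h0W' hμ hα
    -- the twisted parameter `c α`, `c = q^{-s₀}`, is an `L²` Satake parameter of `P`; Jacquet–Shalika bounds it by `√q`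
    set c : ℂ := (v.residueCard : ℂ) ^ (-s₀) with hc
    have h1 : π₁.1.HasSatakeParamAt v (α.map (c * ·)) :=
      AutomorphicRepData.HasSatakeParamAt.of_map_mulChar_detTwist_of_cpow hχ h1W h1W' hα
    obtain ⟨𝔫, ϖ, h𝔫, hv𝔫, hsat⟩ := (hasSatakeParamAt_iff_L2_holds hcpt μm hP v _).1 h1
    have hfam : IsSatakeFamilyOf P ({v}ᶜ : Set (HeightOneSpectrum (𝓞 K))) (fun _ => α.map (c * ·)) := by
      intro v' hv'
      have hv'v : v' = v := by simpa using hv'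
      subst hv'v
      exact ⟨𝔫, h𝔫, hv𝔫, ϖ, hsat⟩
    have hcn : ‖c‖ = (v.residueCard : ℝ) ^ (-s₀.re) := by
      rw [hc, ← Complex.ofReal_natCast, Complex.norm_cpow_eq_rpow_re_of_pos hq, Complex.neg_re]
    have hc0 : 0 < ‖c‖ := by rw [hcn]; exact Real.rpow_pos_of_pos hq _
    -- upper bound for every parameter
    have hupper : ∀ b ∈ α, ‖b‖ ≤ (v.residueCard : ℝ) ^ ((r + 1) / 2) := by
      intro b hb
      have hjs : ‖c * b‖ ≤ Real.sqrt (v.residueCard : ℝ) :=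
        norm_satakeParameter_le_sqrt_holds P hfam (by simp) (Multiset.mem_map_of_mem _ hb)
      rw [norm_mul] at hjs
      have hb' : ‖b‖ ≤ Real.sqrt (v.residueCard : ℝ) / ‖c‖ := by
        rw [le_div_iff₀ hc0, mul_comm]; exact hjs
      refine hb'.trans_eq ?_
      rw [Real.sqrt_eq_rpow, hcn, Real.rpow_neg hq.le, div_inv_eq_mul, ← Real.rpow_add hq]
      congr 1
      linarith
    intro a ha
    refine ⟨hne a ha, ?_, hupper a ha⟩
    -- lower bound from the shadow: `q^r a⁻¹ = conj b` for some parameter `b`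
    have hmem : (((v.residueCard : ℝ) ^ r : ℝ) : ℂ) * a⁻¹ ∈ α.map conj := by
      rw [hconj]; exact Multiset.mem_map_of_mem _ ha
    obtain ⟨b, hb, hbeq⟩ := Multiset.mem_map.1 hmem
    have ha0 : 0 < ‖a‖ := norm_pos_iff.2 (hne a ha)
    have hqr : (0 : ℝ) < (v.residueCard : ℝ) ^ r := Real.rpow_pos_of_pos hq _
    have hb1 : ‖b‖ = (v.residueCard : ℝ) ^ r * ‖a‖⁻¹ := by
      rw [← Complex.norm_conj b, hbeq, norm_mul, norm_inv, Complex.norm_real, Real.norm_of_nonneg hqr.le]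
    have hb2 := hupper b hb
    rw [hb1, mul_inv_le_iff₀ ha0] at hb2
    -- `q^r ≤ q^{(r+1)/2} ‖a‖`  ⇒  `q^{(r-1)/2} ≤ ‖a‖`
    have hsplit : (v.residueCard : ℝ) ^ r = (v.residueCard : ℝ) ^ ((r + 1) / 2) * (v.residueCard : ℝ) ^ ((r - 1) / 2) := by
      rw [← Real.rpow_add hq]; congr 1; ring
    rw [hsplit] at hb2
    exact le_of_mul_le_mul_left hb2 (Real.rpow_pos_of_pos hq _)
  -- the window on the Galois side: `w = -r`, at every place where `π` is ρ-compatible and `π₀` is unramified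
  refine ⟨-r, ?_⟩
  have h0cof : ∀ᶠ v : HeightOneSpectrum (𝓞 K) in Filter.cofinite, π₀.1.IsUnramifiedAt v := π₀.1.hasSatakeParamAt_cofinite_holds
  filter_upwards [hcomp, h0cof] with v hv h0v
  intro Q hQ β hβ
  have hq : (0 : ℝ) < (v.residueCard : ℝ) := by exact_mod_cast Nat.zero_lt_of_lt v.one_lt_residueCard
  obtain ⟨α, hπα, -, hFrob⟩ := hv
  obtain ⟨β₀, hβ₀⟩ := h0v
  have hα0 : π₀.1.HasSatakeParamAt v α := (π.1.hasSatakeParamAt_unique_holds hπα (h0π v β₀ hβ₀)) ▸ hβ₀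
  -- `Q` is THE Frobenius polynomial: `Q = ∏ (X - ι⁻¹(a⁻¹))`
  obtain ⟨𝔓, h𝔓⟩ := v.primesAbove_nonempty
  obtain ⟨σ, hσ⟩ := HeightOneSpectrum.exists_isArithFrobAt_of_mem_primesAbove_holds h𝔓
  have hQeq : Q = arithFrobPolyOfSatake ι v.residueCard 1 α := by rw [← hQ 𝔓 h𝔓 σ hσ, ← hFrob 𝔓 h𝔓 σ hσ]
  rw [hQeq, roots_arithFrobPolyOfSatake] at hβ
  obtain ⟨a, ha, rfl⟩ := Multiset.mem_map.1 hβ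
  simp only [Nat.sub_self, pow_zero, one_mul, RingEquiv.apply_symm_apply, norm_inv]
  obtain ⟨ha0, hlo, hhi⟩ := key v α hα0 a ha
  have hapos : 0 < ‖a‖ := norm_pos_iff.2 ha0
  constructor
  · have e : (-r - 1) / 2 = -((r + 1) / 2) := by ring
    rw [e, Real.rpow_neg hq.le]
    exact inv_anti₀ hapos hhi
  · have e : (-r + 1) / 2 = -((r - 1) / 2) := by ring
    rw [e, Real.rpow_neg hq.le]
    exact inv_anti₀ (Real.rpow_pos_of_pos hq _) hlo

/-- GWW is S-implied (through the target). [folklore] -/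
theorem gww_of_target (h : Summit.Langlands.Langlands.Theses.PrimeSwitchSplit.WeakGeometricAutomorphy) : GaloisWeightWindow := gww_of_weakAut h

/-- GWW is S-implied. [folklore] -/
theorem gww_of_langlands (hL : _root_.Langlands) : GaloisWeightWindow := gww_of_weakAut (target_of_langlands hL)

/-- **the carving loses nothing**: crux ∧ residual ⟺ target (both cells are restrictions of `B_w`, the off-window cell is S-void). [folklore] -/
theorem pieces_iff_target : (GaloisWeightWindow ∧ WindowedWeakAutomorphy) ↔ Summit.Langlands.Langlands.Theses.PrimeSwitchSplit.WeakGeometricAutomorphy :=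
  ⟨fun h => closes_child h.1 h.2, fun h => ⟨gww_of_weakAut h, wwa_of_target h⟩⟩

/-- hence the pieces are S-implied jointly. [folklore] -/
theorem pieces_of_langlands (hL : _root_.Langlands) : GaloisWeightWindow ∧ WindowedWeakAutomorphy :=
  pieces_iff_target.2 (target_of_langlands hL)

/-- under the crux the whole target reduces to its windowed cell. [folklore] -/
theorem target_iff_wwa_of_gww (hG : GaloisWeightWindow) : Summit.Langlands.Langlands.Theses.PrimeSwitchSplit.WeakGeometricAutomorphy ↔ WindowedWeakAutomorphy :=
  ⟨wwa_of_target, closes_child hG⟩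

end Kernel

/-! ## BC5 rungs of the crux (texts = GWW + one inserted hypothesis / n := 1) -/

/-- rung (PROVED): GWW on FINITE-ORDER ρ — Artin-type representations, where `B_w` is the strong Artin conjecture (OPEN for `n ≥ 2`
beyond the solvable / odd two-dimensional cases), while the window is decidable matrix algebra (`w = 0`); node-local statement,
PROVED below as `finiteOrderWindowRung` (no fact tag). -/
def FiniteOrderWindowRung : Prop :=
  ∀ (K : Type) [Field K] [NumberField K] (n : ℕ), 0 < n → ∀ (ℓ : ℕ) [Fact ℓ.Prime] (ι : PadicAlgCl ℓ ≃+* ℂ) (ρ : Literature.NumberTheory.GaloisRepresentations.FramedGaloisRep K (PadicAlgCl ℓ) n), ρ.toGaloisRep.IsIrreducible → (∃ k : ℕ, 0 < k ∧ ∀ σ : Field.absoluteGaloisGroup K, ρ σ ^ k = 1) → ((∀ᶠ v : IsDedekindDomain.HeightOneSpectrum (NumberField.RingOfIntegers K) in cofinite, ρ.IsUnramifiedAt v) ∧ ∀ (v : IsDedekindDomain.HeightOneSpectrum (NumberField.RingOfIntegers K)) (hv : ((ℓ : ℕ) : NumberField.RingOfIntegers K) ∈ v.asIdeal), (Literature.NumberTheory.PAdicHodge.fontainePstAdicCompletion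 v ℓ hv).IsDeRhamFramed (ρ.toLocal v)) → (∃ w : ℝ, ∀ᶠ v : IsDedekindDomain.HeightOneSpectrum (NumberField.RingOfIntegers K) in Filter.cofinite, ∀ P : Polynomial (PadicAlgCl ℓ), ρ.HasFrobCharpolyAt v P → ∀ β ∈ P.roots, (v.residueCard : ℝ) ^ ((w - 1) / 2) ≤ ‖ι β‖ ∧ ‖ι β‖ ≤ (v.residueCard : ℝ) ^ ((w + 1) / 2))

/-- rung (plan-only, PRINT: Weil 1956 / Serre 1968, Ch. III: a geometric ℓ-adic character is locally algebraic, hence attached to an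
algebraic Hecke character of some weight `w`, `|ι χ(Frob_v)| = q_v^{w/2}`): GWW at `n = 1`. [conjecture] -/
def RankOneWindowRung : Prop :=
  ∀ (K : Type) [Field K] [NumberField K] (ℓ : ℕ) [Fact ℓ.Prime] (ι : PadicAlgCl ℓ ≃+* ℂ) (ρ : Literature.NumberTheory.GaloisRepresentations.FramedGaloisRep K (PadicAlgCl ℓ) 1), ρ.toGaloisRep.IsIrreducible → ((∀ᶠ v : IsDedekindDomain.HeightOneSpectrum (NumberField.RingOfIntegers K) in cofinite, ρ.IsUnramifiedAt v) ∧ ∀ (v : IsDedekindDomain.HeightOneSpectrum (NumberField.RingOfIntegers K)) (hv : ((ℓ : ℕ) : NumberField.RingOfIntegers K) ∈ v.asIdeal), (Literature.NumberTheory.PAdicHodge.fontainePstAdicCompletion v ℓ hv).IsDeRhamFramed (ρ.toLocal v)) → (∃ w : ℝ, ∀ᶠ v : IsDedekindDomain.HeightOneSpectrum (NumberField.RingOfIntegers K) in Filter.cofinite, ∀ P : Polynomial (PadicAlgCl ℓ), ρ.HasFrobCharpolyAt v P → ∀ β ∈ P.roots, (v.residueCard : ℝ) ^ ((w - 1) /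 2) ≤ ‖ι β‖ ∧ ‖ι β‖ ≤ (v.residueCard : ℝ) ^ ((w + 1) / 2))

/-- the finite-order rung is a restriction of the crux. [folklore] -/
theorem finiteOrderWindowRung_of_gww (h : GaloisWeightWindow) : FiniteOrderWindowRung :=
  fun K _ _ n hn ℓ _ ι ρ hirr _ hgeo => h K n hn ℓ ι ρ hirr hgeo

/-- the rank-one rung is a restriction of the crux. [folklore] -/
theorem rankOneWindowRung_of_gww (h : GaloisWeightWindow) : RankOneWindowRung :=
  fun K _ _ ℓ _ ι ρ hirr hgeo => h K 1 Nat.one_pos ℓ ι ρ hirr hgeo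

/-- **the finite-order rung HOLDS** (kernel; `hasWeightWindow_of_finiteOrder`). [folklore] -/
theorem finiteOrderWindowRung : FiniteOrderWindowRung :=
  fun K _ _ n hn ℓ _ ι ρ _ hfin _ => by
    obtain ⟨k, hk, hρ⟩ := hfin
    exact hasWeightWindow_of_finiteOrder ι ρ hk hρ

end Summit.Langlands.Langlands.Theorems.SatakeWindowCarving
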